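import Summits.Schanuel.Schanuel.Theorems.ZilberEacIrrationalPoleFibreRamified
import Summits.Schanuel.Schanuel.Theorems.ZilberEacIrrationalPhaseBranch
import Summits.Schanuel.Schanuel.Theorems.ZilberEacPlaneCurvePolyFibres
import HarnessLib

/-!
# Arbitrary base branches, LXXV: EVERY real irrational asymptotic direction — simple or multiple
# root of the top form — gives case ∧ dense for every polynomial fibre; the irrational parabola
# `(x₁ − √2·x₀)² = x₀`

HONEST FRAMING.  Cell `pub-schanuel` (Zilber's Exponential-Algebraic Closedness, case ladder;
host summit Schanuel), seat 2, gen 32.  File LXXIII settled plane curves with a SIMPLE real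
irrational root of the top form (unramified place).  A MULTIPLE root `a` is still the direction of
a place, now possibly ramified with equal pole orders: `x₀ = s^{-e}`, `x₁ = Φ(s)s^{-e}`,
`Φ(0) = a` (Newton–Puiseux at infinity, file LX(a) `exists_place_of_weightedTopRow` with weights
`(1, 1)`).  Along it every fibre value `ψ(s)s^L` is dense: `L = 0` by file LXXII
(`unprojectedDense_branch_unitFibre_irrational`, every `e`), `L ≠ 0` by file LXXIV(b)
(`unprojectedDense_branch_poleFibre_irrational'`, every `e`, every Puiseux tail).  Hence:
* **`unprojectedDense_branch_irrational`** — the germ statement for every `e ≥ 1`, every `L`;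
* **`unprojectedDensityQuestion_planeCurve_polyFibre_irrationalDirection`** — `F` irreducible of
  `x₁`-degree `≥ 2` whose top form `T(t) = F_N(1, t)` (`T ≠ 0`) has a real irrational root:
  `{F = 0, y₀ = R}` is in Mantova–Masser's case AND dense, for EVERY `R` nonzero on the curve;
* **`unprojectedDensityQuestion_irrationalParabola_polyFibre`** — `(x₁ − √2x₀)² = x₀` (top form
  `(t − √2)²`, a DOUBLE root; place `x₀ = s^{-2}`, `x₁ = (√2 + s)s^{-2}`, a Puiseux term below the
  ramification order, outside file LXXI): every polynomial fibre case ∧ dense.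
After this file the bad-direction class over `x₀ = ∞` is reduced to the RESONANT residue class:
places all of whose top phases `Φ(0)z^M` (`z^k = 2πi`) lie in `2πiℚ` — for equal orders, RATIONAL
real directions whose sheared coordinate `qx₁ − px₀` is again unbounded with every direction bad
(neither a rational asymptote, file LXVIII(b), nor transported growth, file LXIX).  Decided
instances of an OPEN question (Mantova–Masser, PLMS 2024 §1 p. 5); EC(3,2) OPEN; NOT Schanuel's
conjecture (neither used nor implied); EAC ⇏ SC.
-/

noncomputable section

open Filter Topology Set Complex Polynomial
open Literature.NumberTheory.Transcendental Literature.ModelTheory.Zilber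
open Literature.ModelTheory.ExponentialFields

set_option linter.dupNamespace false

namespace Summit.Schanuel.Schanuel.Theorems

/-! ## Part A. The germ: every fibre value along every equal-order real-irrational place -/

/-- **Equal pole orders, real IRRATIONAL direction: every fibre value is dense, for every
ramification.**  A cylinder germ `(s^{-k}, Φ(s)s^{-k}, ψ(s)s^L, e^{x₁})` (`k ≥ 1`, `ψ(0) ≠ 0`,
`Φ(0) = a ∈ ℝ ∖ ℚ`, any `L ∈ ℤ`) in an irreducible closed `S` of dimension `≤ 2` has
`I(S ∩ Γ_exp) = I(S)`: `L = 0` by file LXXII, `L ≠ 0` by file LXXIV(b).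
[cite: MantovaMasser2023, §1 Further remarks, p. 5 (the question, open in general)] (new) -/
theorem unprojectedDense_branch_irrational {S : Set (Fin 2 ⊕ Fin 2 → ℂ)}
    (hS : IsIrreducibleClosed ℂ S) (hdim : zariskiDim ℂ S ≤ (2 : ℕ))
    {k : ℕ} (hk : 1 ≤ k) (L : ℤ) {ψ : ℂ → ℂ} (hψ : AnalyticAt ℂ ψ 0) (hψ0 : ψ 0 ≠ 0)
    {Φ : ℂ → ℂ} (hΦ : AnalyticAt ℂ Φ 0) {a : ℝ} (ha : Irrational a) (hΦ0 : Φ 0 = a)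
    (hgerm : ∀ᶠ s in 𝓝[≠] (0 : ℂ),
      (Sum.elim ![(s ^ k)⁻¹, Φ s * (s ^ k)⁻¹] ![ψ s * s ^ L, Complex.exp (Φ s * (s ^ k)⁻¹)] :
        Fin 2 ⊕ Fin 2 → ℂ) ∈ S) :
    UnprojectedDense S := by
  rcases eq_or_ne L 0 with rfl | hL
  · refine unprojectedDense_branch_unitFibre_irrational hS hdim hk hψ hψ0 rfl hΦ ha hΦ0 ?_
    filter_upwards [hgerm] with s hs
    rwa [zpow_zero, mul_one] at hs
  · exact unprojectedDense_branch_poleFibre_irrational' hS hdim hk hL hψ hψ0 hΦ ha hΦ0 hgerm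

/-! ## Part B. Curves: every real irrational root of the top form -/

section PlaneCurve

variable (F : ℂ[X][X])

/-- **`S`-form along an equal-order real-irrational place.**  `F` irreducible of positive
`x₁`-degree; a place `x₀ = s^{-k}`, `x₁ = Φ(s)s^{-k}` (`k ≥ 1`) with `Φ(0) = a ∈ ℝ ∖ ℚ`;
`R ∈ ℂ[x₀, x₁]` nonzero somewhere on the curve; `S` irreducible closed of dimension `≤ 2` containing
`(x, R(x), e^{x₁})` for every `x` on the curve.  Then `S` has Zariski-dense exponential points.
[cite: MantovaMasser2023, §1 Further remarks, p. 5 (the question, open in general)] (new) -/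
theorem unprojectedDense_planeCurve_polyFibre_irrationalPlace' (hFirr : Irreducible F)
    (hn : 1 ≤ F.natDegree) {k : ℕ} (hk : 1 ≤ k) {Φ : ℂ → ℂ} (hΦan : AnalyticAt ℂ Φ 0) {a : ℝ}
    (ha : Irrational a) (hΦ0 : Φ 0 = a)
    (hplace : ∀ᶠ s in 𝓝[≠] (0 : ℂ),
      (F.map (Polynomial.evalRingHom (s ^ k)⁻¹)).eval (Φ s * (s ^ k)⁻¹) = 0)
    (R : MvPolynomial (Fin 2) ℂ)
    (hR : ∃ x y : ℂ, (F.map (Polynomial.evalRingHom x)).eval y = 0 ∧ MvPolynomial.eval ![x, y] R ≠ 0)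
    {S : Set (Fin 2 ⊕ Fin 2 → ℂ)} (hS : IsIrreducibleClosed ℂ S) (hdim : zariskiDim ℂ S ≤ (2 : ℕ))
    (hsub : ∀ x y : ℂ, (F.map (Polynomial.evalRingHom x)).eval y = 0 →
      (Sum.elim ![x, y] ![MvPolynomial.eval ![x, y] R, Complex.exp y] : Fin 2 ⊕ Fin 2 → ℂ) ∈ S) :
    UnprojectedDense S := by
  classical
  obtain ⟨Φr, hΦr⟩ := exists_rowsEquiv
  have hndvd : ¬ F ∣ Φr R := by
    refine not_dvd_of_exists_eval_ne_zero F ?_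
    obtain ⟨x, y, hxy, hne⟩ := hR
    exact ⟨x, y, hxy, by rw [← hΦr]; exact hne⟩
  obtain ⟨ψ, L, hψan, hψ0, hf⟩ :=
    exists_rows_place_normalForm F hFirr hn (Φr R) hndvd hk k hΦan hplace
  refine unprojectedDense_branch_irrational hS hdim hk L hψan hψ0 hΦan ha hΦ0 ?_
  filter_upwards [hplace, hf] with s hs hfs
  have hmem := hsub _ _ hs
  rwa [hΦr, hfs] at hmem

/-- **Mantova–Masser's question over a plane curve with a REAL IRRATIONAL asymptotic direction
(any multiplicity): case ∧ dense for every polynomial fibre.**  `F ∈ ℂ[x₀][x₁]` irreducible of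
`x₁`-degree `≥ 2`; `Q(s, t) = F(s, st)` with rows of degree `≤ N` and nonzero top row `T`
(`= F_N(1, t)`); `a ∈ ℝ ∖ ℚ` a root of `T`; `R` nonzero somewhere on the curve.  Then
`{F = 0, y₀ = R(x₀, x₁)}` is an irreducible surface with `dim π_add = 1`, on no vertical line,
additively free, AND its exponential points are Zariski dense.
[cite: MantovaMasser2023, §1 Further remarks, p. 5 (the question, open in general)] (new) -/
theorem unprojectedDensityQuestion_planeCurve_polyFibre_irrationalDirection (hFirr : Irreducible F)
    (hn : 2 ≤ F.natDegree) (Q : ℂ[X][X])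
    (hQ : ∀ s t : ℂ, (Q.map (Polynomial.evalRingHom s)).eval t =
      (F.map (Polynomial.evalRingHom s)).eval (s * t))
    (N : ℕ) (hN : ∀ j, (Q.coeff j).natDegree ≤ N) (T : ℂ[X]) (hT : ∀ j, T.coeff j = (Q.coeff j).coeff N)
    (hT0 : T ≠ 0) {a : ℝ} (ha : Irrational a) (hTa : T.IsRoot (a : ℂ))
    (R : MvPolynomial (Fin 2) ℂ)
    (hR : ∃ x y : ℂ, (F.map (Polynomial.evalRingHom x)).eval y = 0 ∧ MvPolynomial.eval ![x, y] R ≠ 0) :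
    MMCaseDimPiOneFree {w : Fin 2 ⊕ Fin 2 → ℂ |
        (F.map (Polynomial.evalRingHom (w (Sum.inl 0)))).eval (w (Sum.inl 1)) = 0 ∧
        w (Sum.inr 0) = MvPolynomial.eval ![w (Sum.inl 0), w (Sum.inl 1)] R} ∧
      UnprojectedDense {w : Fin 2 ⊕ Fin 2 → ℂ |
        (F.map (Polynomial.evalRingHom (w (Sum.inl 0)))).eval (w (Sum.inl 1)) = 0 ∧
        w (Sum.inr 0) = MvPolynomial.eval ![w (Sum.inl 0), w (Sum.inl 1)] R} := by
  classical
  refine ⟨mmCase_planeCurve_polyFibre F hFirr hn R hR, ?_⟩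
  have hQ' : ∀ s t : ℂ, (Q.map (Polynomial.evalRingHom s)).eval t =
      (F.map (Polynomial.evalRingHom (s ^ 1))).eval (s ^ 1 * t) := fun s t => by
    rw [pow_one]; exact hQ s t
  obtain ⟨e, Φ, he, hΦan, hΦ0, hplace⟩ := exists_place_of_weightedTopRow F
    (exists_bezout_derivative hFirr (by omega)) le_rfl 1 Q hQ' N hN T hT hT0 hTa
  rw [mul_one] at hplace
  obtain ⟨Φr, hΦr⟩ := exists_rowsEquiv
  set A : MvPolynomial (Fin 2) ℂ := Φr.symm F with hA
  have hPQ : ∀ x y : ℂ, MvPolynomial.eval ![x, y] A = (F.map (Polynomial.evalRingHom x)).eval y := by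
    intro x y
    rw [hΦr, hA, RingEquiv.apply_symm_apply]
  have hirrA : Irreducible A := (irreducible_rows_iff hPQ).2 hFirr
  have hset : {w : Fin 2 ⊕ Fin 2 → ℂ |
      (F.map (Polynomial.evalRingHom (w (Sum.inl 0)))).eval (w (Sum.inl 1)) = 0 ∧
      w (Sum.inr 0) = MvPolynomial.eval ![w (Sum.inl 0), w (Sum.inl 1)] R} =
      {w : Fin 2 ⊕ Fin 2 → ℂ | MvPolynomial.eval ![w (Sum.inl 0), w (Sum.inl 1)] A = 0 ∧
        w (Sum.inr 0) = MvPolynomial.eval ![w (Sum.inl 0), w (Sum.inl 1)] R} := by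
    ext w
    simp only [Set.mem_setOf_eq, hPQ]
  rw [hset]
  refine unprojectedDense_planeCurve_polyFibre_irrationalPlace' F hFirr (by omega) he hΦan ha hΦ0
    hplace R hR (isIrreducibleClosed_curveGraphFibre R hirrA)
    (le_of_eq (zariskiDim_curveGraphFibre R hirrA)) fun x y hxy => ?_
  refine ⟨?_, ?_⟩
  · simp only [Sum.elim_inl, Matrix.cons_val_zero, Matrix.cons_val_one]
    rw [hPQ]
    exact hxy
  · simp only [Sum.elim_inr, Sum.elim_inl, Matrix.cons_val_zero, Matrix.cons_val_one]

/-- **Rational fibres along an equal-order real-irrational place** (any ramification `k ≥ 1`).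
[cite: MantovaMasser2023, §1 Further remarks, p. 5 (the question, open in general)] (new) -/
theorem unprojectedDense_planeCurve_rationalFibre_irrationalPlace' (hFirr : Irreducible F)
    (hn : 1 ≤ F.natDegree) {k : ℕ} (hk : 1 ≤ k) {Φ : ℂ → ℂ} (hΦan : AnalyticAt ℂ Φ 0) {a : ℝ}
    (ha : Irrational a) (hΦ0 : Φ 0 = a)
    (hplace : ∀ᶠ s in 𝓝[≠] (0 : ℂ),
      (F.map (Polynomial.evalRingHom (s ^ k)⁻¹)).eval (Φ s * (s ^ k)⁻¹) = 0)
    (R Q : MvPolynomial (Fin 2) ℂ)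
    (hR : ∃ x y : ℂ, (F.map (Polynomial.evalRingHom x)).eval y = 0 ∧ MvPolynomial.eval ![x, y] R ≠ 0)
    (hQ : ∃ x y : ℂ, (F.map (Polynomial.evalRingHom x)).eval y = 0 ∧ MvPolynomial.eval ![x, y] Q ≠ 0)
    {S : Set (Fin 2 ⊕ Fin 2 → ℂ)} (hS : IsIrreducibleClosed ℂ S) (hdim : zariskiDim ℂ S ≤ (2 : ℕ))
    (hsub : ∀ x y : ℂ, (F.map (Polynomial.evalRingHom x)).eval y = 0 →
      MvPolynomial.eval ![x, y] Q ≠ 0 →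
      (Sum.elim ![x, y] ![MvPolynomial.eval ![x, y] R / MvPolynomial.eval ![x, y] Q, Complex.exp y] :
        Fin 2 ⊕ Fin 2 → ℂ) ∈ S) :
    UnprojectedDense S := by
  classical
  obtain ⟨Φr, hΦr⟩ := exists_rowsEquiv
  have hndvdR : ¬ F ∣ Φr R := by
    refine not_dvd_of_exists_eval_ne_zero F ?_
    obtain ⟨x, y, hxy, hne⟩ := hR
    exact ⟨x, y, hxy, by rw [← hΦr]; exact hne⟩
  have hndvdQ : ¬ F ∣ Φr Q := by
    refine not_dvd_of_exists_eval_ne_zero F ?_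
    obtain ⟨x, y, hxy, hne⟩ := hQ
    exact ⟨x, y, hxy, by rw [← hΦr]; exact hne⟩
  obtain ⟨ψR, LR, hψRan, hψR0, hfR⟩ :=
    exists_rows_place_normalForm F hFirr hn (Φr R) hndvdR hk k hΦan hplace
  obtain ⟨ψQ, LQ, hψQan, hψQ0, hfQ⟩ :=
    exists_rows_place_normalForm F hFirr hn (Φr Q) hndvdQ hk k hΦan hplace
  have hψQne : ∀ᶠ s in 𝓝 (0 : ℂ), ψQ s ≠ 0 := hψQan.continuousAt.eventually_ne hψQ0
  refine unprojectedDense_branch_irrational hS hdim hk (LR - LQ) (hψRan.div hψQan hψQ0)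
    (div_ne_zero hψR0 hψQ0) hΦan ha hΦ0 ?_
  filter_upwards [hplace, hfR, hfQ, self_mem_nhdsWithin, nhdsWithin_le_nhds hψQne] with s hs hsR hsQ
    (hs0 : s ≠ 0) hψQs
  have hQne : MvPolynomial.eval ![(s ^ k)⁻¹, Φ s * (s ^ k)⁻¹] Q ≠ 0 := by
    rw [hΦr, hsQ]
    exact mul_ne_zero hψQs (zpow_ne_zero _ hs0)
  have hmem := hsub _ _ hs hQne
  have hval : MvPolynomial.eval ![(s ^ k)⁻¹, Φ s * (s ^ k)⁻¹] R /
      MvPolynomial.eval ![(s ^ k)⁻¹, Φ s * (s ^ k)⁻¹] Q = ψR s / ψQ s * s ^ (LR - LQ) := by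
    rw [hΦr, hΦr, hsR, hsQ, zpow_sub₀ hs0]
    field_simp
  rw [hval] at hmem
  exact hmem

end PlaneCurve

/-! ## Part C. Example: the irrational parabola `(x₁ − √2·x₀)² = x₀` -/

section IrrationalParabola

/-- The base polynomial `x₁² − 2√2·x₀·x₁ + (2x₀² − x₀) = (x₁ − √2x₀)² − x₀` in `ℂ[x₀][x₁]`. -/
private def ipF : ℂ[X][X] :=
  X ^ 2 + Polynomial.C (Polynomial.C (-(2 * Real.sqrt 2 : ℝ) : ℂ) * X) * X +
    Polynomial.C (Polynomial.C 2 * X ^ 2 - X)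

/-- Auxiliary computation for the example (`ipF_eval`). [folklore] -/
private theorem ipF_eval (x y : ℂ) :
    (ipF.map (Polynomial.evalRingHom x)).eval y =
      y ^ 2 - 2 * (Real.sqrt 2 : ℝ) * x * y + (2 * x ^ 2 - x) := by
  simp [ipF]
  ring

/-- Auxiliary computation for the example (`ipF_coeff`). [folklore] -/
private theorem ipF_coeff (j : ℕ) : ipF.coeff j =
    if j = 2 then 1 else if j = 1 then Polynomial.C (-(2 * Real.sqrt 2 : ℝ) : ℂ) * X
      else if j = 0 then Polynomial.C 2 * X ^ 2 - X else 0 := by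
  simp only [ipF, Polynomial.coeff_add, Polynomial.coeff_X_pow, Polynomial.coeff_C_mul,
    Polynomial.coeff_X, Polynomial.coeff_C]
  rcases j with _ | _ | _ | j <;> simp

/-- Auxiliary computation for the example (`ipF_natDegree`). [folklore] -/
private theorem ipF_natDegree : ipF.natDegree = 2 := by
  refine le_antisymm ?_ ?_
  · refine Polynomial.natDegree_le_iff_coeff_eq_zero.2 fun j hj => ?_
    rw [ipF_coeff]
    have h2 : j ≠ 2 := by omega
    have h1 : j ≠ 1 := by omega
    have h0 : j ≠ 0 := by omega
    simp [h2, h1, h0]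
  · refine Polynomial.le_natDegree_of_ne_zero ?_
    rw [ipF_coeff]
    simp

/-- Auxiliary computation for the example (`ipF_monic`). [folklore] -/
private theorem ipF_monic : ipF.Monic := by
  rw [Polynomial.Monic, Polynomial.leadingCoeff, ipF_natDegree, ipF_coeff]
  simp

/-- `(x₁ − √2x₀)² − x₀` is irreducible: a factorisation `(x₁ + c₁)(x₁ + c₂)` would make the
discriminant `4x₀ = (c₁ − c₂)²` a square in `ℂ[x₀]`, of odd degree. [folklore] -/
private theorem ipF_irreducible : Irreducible ipF := by
  by_contra hirr
  obtain ⟨c₁, c₂, hmul, hadd⟩ :=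
    (ipF_monic.not_irreducible_iff_exists_add_mul_eq_coeff ipF_natDegree).1 hirr
  rw [ipF_coeff] at hmul hadd
  simp only [show ¬ (0 : ℕ) = 2 by norm_num, show ¬ (0 : ℕ) = 1 by norm_num,
    show ¬ (1 : ℕ) = 2 by norm_num, if_false, if_true] at hmul hadd
  -- the discriminant `b² − 4c = (c₁ − c₂)²` is `4x₀`
  have hdisc : (Polynomial.C (4 : ℂ) * X : ℂ[X]) = (c₁ - c₂) ^ 2 := by
    have e : (c₁ - c₂) ^ 2 = (c₁ + c₂) ^ 2 - 4 * (c₁ * c₂) := by ring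
    rw [e, ← hadd, ← hmul]
    have hs : ((-(2 * Real.sqrt 2 : ℝ) : ℂ)) ^ 2 = 8 := by
      have h2 : ((Real.sqrt 2 : ℝ) : ℂ) ^ 2 = 2 := by
        rw [← Complex.ofReal_pow, Real.sq_sqrt (by norm_num : (0 : ℝ) ≤ 2)]; push_cast; rfl
      push_cast
      linear_combination (4 : ℂ) * h2
    rw [mul_pow, ← Polynomial.C_pow, hs]
    simp only [map_ofNat]
    ring
  have hdeg := congrArg Polynomial.natDegree hdisc
  rw [Polynomial.natDegree_C_mul_X _ (by norm_num), Polynomial.natDegree_pow] at hdeg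
  omega

/-- The weighted polynomial `Q(s, t) = F(s, st) = s²t² − 2√2s²t + (2s² − s)`: coefficients.
[folklore] -/
private theorem ipQ_coeff (j : ℕ) :
    (Polynomial.C (X ^ 2 : ℂ[X]) * X ^ 2 +
        Polynomial.C (Polynomial.C (-(2 * Real.sqrt 2 : ℝ) : ℂ) * X ^ 2) * X +
        Polynomial.C (Polynomial.C 2 * X ^ 2 - X : ℂ[X]) : ℂ[X][X]).coeff j =
      if j = 2 then X ^ 2 else if j = 1 then Polynomial.C (-(2 * Real.sqrt 2 : ℝ) : ℂ) * X ^ 2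
        else if j = 0 then Polynomial.C 2 * X ^ 2 - X else 0 := by
  simp only [Polynomial.coeff_add, Polynomial.coeff_C_mul, Polynomial.coeff_X_pow,
    Polynomial.coeff_X, Polynomial.coeff_C]
  rcases j with _ | _ | _ | j <;> simp

/-- **`{(x₁ − √2x₀)² = x₀, y₀ = R(x₀, x₁)}`: case ∧ dense for every `R` nonzero somewhere on the
curve** — a DOUBLE real irrational root `√2` of the top form `(t − √2)²`; the place
`x₀ = s^{-2}`, `x₁ = (√2 + s)s^{-2}` is ramified with a Puiseux term below the ramification order.
[cite: MantovaMasser2023, §1 Further remarks, p. 5 (the question, open in general)] (new) -/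
theorem unprojectedDensityQuestion_irrationalParabola_polyFibre (R : MvPolynomial (Fin 2) ℂ)
    (hR : ∃ x y : ℂ, y ^ 2 - 2 * (Real.sqrt 2 : ℝ) * x * y + (2 * x ^ 2 - x) = 0 ∧
      MvPolynomial.eval ![x, y] R ≠ 0) :
    MMCaseDimPiOneFree {w : Fin 2 ⊕ Fin 2 → ℂ |
        w (Sum.inl 1) ^ 2 - 2 * (Real.sqrt 2 : ℝ) * w (Sum.inl 0) * w (Sum.inl 1) +
          (2 * w (Sum.inl 0) ^ 2 - w (Sum.inl 0)) = 0 ∧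
        w (Sum.inr 0) = MvPolynomial.eval ![w (Sum.inl 0), w (Sum.inl 1)] R} ∧
      UnprojectedDense {w : Fin 2 ⊕ Fin 2 → ℂ |
        w (Sum.inl 1) ^ 2 - 2 * (Real.sqrt 2 : ℝ) * w (Sum.inl 0) * w (Sum.inl 1) +
          (2 * w (Sum.inl 0) ^ 2 - w (Sum.inl 0)) = 0 ∧
        w (Sum.inr 0) = MvPolynomial.eval ![w (Sum.inl 0), w (Sum.inl 1)] R} := by
  have hset : {w : Fin 2 ⊕ Fin 2 → ℂ |
      w (Sum.inl 1) ^ 2 - 2 * (Real.sqrt 2 : ℝ) * w (Sum.inl 0) * w (Sum.inl 1) +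
          (2 * w (Sum.inl 0) ^ 2 - w (Sum.inl 0)) = 0 ∧
      w (Sum.inr 0) = MvPolynomial.eval ![w (Sum.inl 0), w (Sum.inl 1)] R} =
      {w : Fin 2 ⊕ Fin 2 → ℂ |
        (ipF.map (Polynomial.evalRingHom (w (Sum.inl 0)))).eval (w (Sum.inl 1)) = 0 ∧
        w (Sum.inr 0) = MvPolynomial.eval ![w (Sum.inl 0), w (Sum.inl 1)] R} := by
    ext w; simp only [Set.mem_setOf_eq, ipF_eval]
  rw [hset]
  have hsqrt : ((Real.sqrt 2 : ℝ) : ℂ) ^ 2 = 2 := by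
    rw [← Complex.ofReal_pow, Real.sq_sqrt (by norm_num : (0 : ℝ) ≤ 2)]
    push_cast
    rfl
  refine unprojectedDensityQuestion_planeCurve_polyFibre_irrationalDirection _ ipF_irreducible
    (by rw [ipF_natDegree])
    (Polynomial.C (X ^ 2 : ℂ[X]) * X ^ 2 +
      Polynomial.C (Polynomial.C (-(2 * Real.sqrt 2 : ℝ) : ℂ) * X ^ 2) * X +
      Polynomial.C (Polynomial.C 2 * X ^ 2 - X : ℂ[X]))
    (fun s t => by rw [ipF_eval]; simp; ring) 2 ?_
    (X ^ 2 + Polynomial.C (-(2 * Real.sqrt 2 : ℝ) : ℂ) * X + Polynomial.C 2) ?_ ?_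
    irrational_sqrt_two ?_ R ?_
  · intro j
    rw [ipQ_coeff]
    split_ifs
    · simp
    · exact Polynomial.natDegree_C_mul_X_pow_le _ 2
    · compute_degree!
    · simp
  · intro j
    rw [ipQ_coeff, Polynomial.coeff_add, Polynomial.coeff_add, Polynomial.coeff_X_pow,
      Polynomial.coeff_C_mul, Polynomial.coeff_X, Polynomial.coeff_C]
    rcases j with _ | _ | _ | j <;> simp [Polynomial.coeff_X, mul_assoc]
  · intro h
    have h2 := congrArg (fun p : ℂ[X] => p.coeff 2) h
    simp at h2
  · rw [Polynomial.IsRoot, Polynomial.eval_add, Polynomial.eval_add, Polynomial.eval_pow,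
      Polynomial.eval_X, Polynomial.eval_mul, Polynomial.eval_C, Polynomial.eval_X,
      Polynomial.eval_C, hsqrt]
    push_cast
    linear_combination (-2 : ℂ) * hsqrt
  · obtain ⟨x, y, hxy, hne⟩ := hR
    exact ⟨x, y, by rw [ipF_eval]; exact hxy, hne⟩

/-- **`{(x₁ − √2x₀)² = x₀, y₀ = x₁}`: case ∧ dense** (the point `(2, 2√2 + √2) = (2, 3√2)`:
`(3√2 − 2√2)² = 2`). [cite: MantovaMasser2023, §1 Further remarks, p. 5 (the question, open in
general)] (new) -/
theorem unprojectedDensityQuestion_irrationalParabola_fibre_x₁ :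
    MMCaseDimPiOneFree {w : Fin 2 ⊕ Fin 2 → ℂ |
        w (Sum.inl 1) ^ 2 - 2 * (Real.sqrt 2 : ℝ) * w (Sum.inl 0) * w (Sum.inl 1) +
          (2 * w (Sum.inl 0) ^ 2 - w (Sum.inl 0)) = 0 ∧ w (Sum.inr 0) = w (Sum.inl 1)} ∧
      UnprojectedDense {w : Fin 2 ⊕ Fin 2 → ℂ |
        w (Sum.inl 1) ^ 2 - 2 * (Real.sqrt 2 : ℝ) * w (Sum.inl 0) * w (Sum.inl 1) +
          (2 * w (Sum.inl 0) ^ 2 - w (Sum.inl 0)) = 0 ∧ w (Sum.inr 0) = w (Sum.inl 1)} := by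
  have hsqrt : ((Real.sqrt 2 : ℝ) : ℂ) ^ 2 = 2 := by
    rw [← Complex.ofReal_pow, Real.sq_sqrt (by norm_num : (0 : ℝ) ≤ 2)]
    push_cast
    rfl
  have hsqrt0 : ((Real.sqrt 2 : ℝ) : ℂ) ≠ 0 := by
    have : (0 : ℝ) < Real.sqrt 2 := Real.sqrt_pos.2 (by norm_num)
    exact_mod_cast this.ne'
  have h := unprojectedDensityQuestion_irrationalParabola_polyFibre (MvPolynomial.X 1)
    ⟨2, 3 * (Real.sqrt 2 : ℝ), by linear_combination (-3 : ℂ) * hsqrt, by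
      simp only [MvPolynomial.eval_X, Matrix.cons_val_one, Matrix.cons_val_zero]
      exact mul_ne_zero three_ne_zero hsqrt0⟩
  simpa only [MvPolynomial.eval_X, Matrix.cons_val_one, Matrix.cons_val_zero] using h

end IrrationalParabola

end Summit.Schanuel.Schanuel.Theorems

end
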